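import Summits.ValiantsHypothesis.ValiantsHypothesis.Theorems.LacunarySymmetroidMatrixDescartesFiniteSectorPairSumMasks

/-!
# `MatrixDescartes` — line «finite»: PAIR-SUM BITMASKS, SHIFT FORM (bridge theorems for the sliced `m = 2` kernel checks)

HONEST FRAMING.  Object-search cell `pub-symmetroid`, seat val-sym-door-p5 g8.  HELPER material for the crux item `stmt-ValiantsHypothesis-18050` with NO
closure claim and no mathematical content of its own; companion of `…FiniteSectorPairSumMasks`.  For the larger finite cores (`σ(2,8)`, `n(2,9)`: 5·10⁴–10⁵
live prefixes) the pair-sum mask of a value list `l` is written in the cheaper SHIFT FORM (still no definition):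
`PF' l = l.foldr (fun x acc => acc ||| (l.foldr (fun y acc => acc ||| 2 ^ y) 0) * 2 ^ x) 0`
(the value mask `Σ 2^y` shifted by every value `x`: `|l|` multiplications per level instead of `|l|²` powers), with the same atoms
`PF' l % 2^t = 2^t − 1` («`[0,t)` covered») and `(PF' l ||| PF' l / 2) % 2^t = 2^t − 1` («chain alive below `t`»).  This file proves membership ⇒ bit for
`PF'`.  Nothing here bears on the crux, the doors, or `VP ≠ VNP`.
[folklore] Elementary bit bookkeeping (`Nat.testBit`); no citation is load-bearing.
-/

-- `Summit.ValiantsHypothesis.ValiantsHypothesis.…` repeats a component by the D-0017 layout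
-- (single-conjunct summit), which the `dupNamespace` linter flags; the name is mandated.
set_option linter.dupNamespace false

namespace Summit.ValiantsHypothesis.ValiantsHypothesis.Theorems.LacunarySymmetroidMatrixDescartes.FiniteSector

/-! ## Bit bookkeeping for the shift form -/

/-- Bits of the VALUE MASK fold `l₂.foldr (fun y acc => acc ||| 2 ^ y) acc`: bit `r` is set iff it is set in `acc` or `r ∈ l₂`. [folklore] -/
theorem testBit_valFold (l₂ : List ℕ) (acc r : ℕ) :
    (l₂.foldr (fun y acc => acc ||| 2 ^ y) acc).testBit r = true ↔ (acc.testBit r = true ∨ r ∈ l₂) := by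
  induction l₂ generalizing acc with
  | nil => simp
  | cons y ys ih =>
    simp only [List.foldr_cons, Nat.testBit_lor, Bool.or_eq_true, Nat.testBit_two_pow, decide_eq_true_eq,
      List.mem_cons]
    rw [ih]
    constructor
    · rintro ((h | h) | h)
      exacts [Or.inl h, Or.inr (Or.inr h), Or.inr (Or.inl h.symm)]
    · rintro (h | h | h)
      exacts [Or.inl (Or.inl h), Or.inr h.symm, Or.inl (Or.inr h)]

/-- Bits of the SHIFT fold `l.foldr (fun x acc => acc ||| V * 2 ^ x) acc`: bit `r` is set iff it is set in `acc` or bit `r − x` of `V` is set for some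
`x ∈ l`, `x ≤ r`. [folklore] -/
theorem testBit_shiftFold (l : List ℕ) (V acc r : ℕ) :
    (l.foldr (fun x acc => acc ||| V * 2 ^ x) acc).testBit r = true ↔
      (acc.testBit r = true ∨ ∃ x ∈ l, x ≤ r ∧ V.testBit (r - x) = true) := by
  induction l generalizing acc with
  | nil => simp
  | cons x xs ih =>
    simp only [List.foldr_cons, Nat.testBit_lor, Bool.or_eq_true, Nat.testBit_mul_two_pow, Bool.and_eq_true,
      decide_eq_true_eq, List.mem_cons, exists_eq_or_imp]
    rw [ih]
    constructor
    · rintro ((h | h) | h)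
      exacts [Or.inl h, Or.inr (Or.inr h), Or.inr (Or.inl h)]
    · rintro (h | h | h)
      exacts [Or.inl (Or.inl h), Or.inr h, Or.inl (Or.inr h)]

/-- **Membership ⇒ bit (shift form).**  A pair sum `r = x + y` (`x, y ∈ l`) sets bit `r` of
`l.foldr (fun x acc => acc ||| (l.foldr (fun y acc => acc ||| 2 ^ y) 0) * 2 ^ x) 0`. [folklore] -/
theorem testBit_pairFoldShift_of_mem {l : List ℕ} {r : ℕ} (h : ∃ x ∈ l, ∃ y ∈ l, x + y = r) :
    (l.foldr (fun x acc => acc ||| (l.foldr (fun y acc => acc ||| 2 ^ y) 0) * 2 ^ x) 0).testBit r = true := by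
  rw [testBit_shiftFold]
  obtain ⟨x, hx, y, hy, hxy⟩ := h
  refine Or.inr ⟨x, hx, by omega, ?_⟩
  rw [testBit_valFold]
  refine Or.inr ?_
  have : r - x = y := by omega
  rw [this]
  exact hy

end Summit.ValiantsHypothesis.ValiantsHypothesis.Theorems.LacunarySymmetroidMatrixDescartes.FiniteSector
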